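/-
Copyright (c) 2026 the pub-hodgecm-mathlib formalisation cell (harness21).  Prover seat hodgecm-mathlib-K2Liu-p09 (g5): Track B «K2-LIT»,
hLiu418 = stmt-HodgeConjecture-24832; LEAD F0P6-plan (g12) RULING M-156m 2026-09-04T07:51:54Z «A7 = GK COCYCLE ROAD», file B5a.
-/
import Summits.HodgeConjecture.HodgeConjecture.Theorems.K2LiuGKRankOneIntegral     -- ★ GK rank-one file (1): `one_lt_residueFieldCard_real`, outward shells from `𝒪` (imports `LocalFieldHaarBalls`)
import Literature.NumberTheory.Automorphic.GL2RSLFactorExistence               -- ★ `exists_finset_primePowBall_eq_biUnion` (`𝔭^j = ⨆_{y∈R}(y + 𝔭^r)`)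
import Literature.NumberTheory.Automorphic.AddCharConductorExponent               -- ★ `exists_normAbs_eq_inv_zpow`, `add_mem_primePowBall`
import Mathlib.Analysis.SpecialFunctions.Pow.Complex
import Mathlib.Analysis.SpecificLimits.Normed
import HarnessLib

/-!
# Crux `HLiu418`, road `K2_Liu`, organ A7-reg (RULING M-156m, GK cocycle road), file B5a:
# THE RANK-ONE INTERTWINING INTEGRAL AT LEVEL `K′` — shells, the HEAD as a finite coset sum, the TAIL shell by shell

Cell `hodgecm-mathlib`, crux item hLiu418 = `stmt-HodgeConjecture-24832`; squad K2 ∕ K2Liu; prover K2Liu-p09 (g5).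
THEOREMS ONLY (no `def`, no instance, no notation, no named-fact hypothesis, no `sorry`); lane `--supports stmt-HodgeConjecture-24832`
(count-neutral helper).  Companion file B5b `K2LiuRankOneLevelHolomorphy` assembles HEAD + TAIL and the completion form.

THE OBJECT.  In the Gindikin–Karpelevich cocycle `M_w(s) = A₂∘A₁∘A₂` for the Siegel intertwining operator of the doubled `U(2,2)`
(A7 census `K2/K2Liu-p09/g5/REPORT-FIRST-A7-BadPlaceRegularity.K2Liu-p09-g5.md` §3), each rank-one factor applied to a section right-invariant
under a principal congruence subgroup of level `m` is — after the `SL₂` identity `w u(x) = u(−1/x) α^∨(1/x) ū(1/x)` — the integral over the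
root line `𝕜` (`= F_v` or `E_w`) of a function `g : 𝕜 → ℂ` LOCALLY CONSTANT modulo `𝔭^r` on the HEAD ball `𝔭^n` and equal to
`C · ν(x)⁻¹ · ‖x‖^{−e}` on the TAIL `𝕜 ∖ 𝔭^n` (`ν = λ∘α^∨` unitary, `re e > 1`).  This file, for ANY non-archimedean local field and additive
Haar measure: §1 the outward shells `𝕜 ∖ 𝔭^n = ⨆_{j ≥ 0} {‖x‖ = q^{j+1−n}}` and their measures; §2 with `𝔭^n = ⨆_{y∈R}(y + 𝔭^r)` for a finite `R`
(★ `exists_finset_primePowBall_eq_biUnion` of `GL2RSLFactorExistence`), `∫_{𝔭^n} g = Σ_{y∈R} μ(𝔭^r) g(y)` for `g` constant on the translates; §3 the TAIL: on one shell the integral is `C (1 − q⁻¹) μ(𝒪) (ν(ϖ) q^{1−e})^{j+1−n}`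
for UNRAMIFIED `ν`, and `0` for RAMIFIED `ν` (translation by a unit `u₀` with `ν(u₀) ≠ 1` preserves shell and measure and multiplies the
integrand by `ν(u₀)⁻¹ ≠ 1` — bad characters are EASIER); integrability on the tail and the shell-by-shell sum (geometric, ratio `q^{1−re e}`).
HONEST LABEL.  `HC_CM` is proved only modulo the 7 printed citations (2 remaining named inputs: hLiu418 = `stmt-HodgeConjecture-24832`,
h413 = `stmt-HodgeConjecture-24833`) until rung 0 closes.

## References
* [Casselman1980] W. Casselman, *The unramified principal series of p-adic groups I*, Compositio Math. 40 (1980), §3 (rank-one `c_α`, `T_w = Π T_α`).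
* [Tate1950] J. Tate, *Fourier analysis in number fields and Hecke's zeta-functions* (1950), §2.2 Lemma 2.2.5, §2.4–2.5 (shell sums).
* [BushnellHenniart2006] C. J. Bushnell, G. Henniart, *The local Langlands conjecture for GL(2)* (2006), §1.1 (congruence balls, level).
-/

set_option autoImplicit false
set_option linter.dupNamespace false -- the mandated namespace repeats `HodgeConjecture.HodgeConjecture`

noncomputable section

open MeasureTheory Filter Topology Set
open scoped NNReal ENNReal
open Literature.NumberTheory.GaloisRepresentations.IsNonarchimedeanLocalField
open Literature.NumberTheory.Automorphic Literature.NumberTheory.Automorphic.LocalFieldHaar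
open Summit.HodgeConjecture.HodgeConjecture.Cruxes.HLiu418.K2LiuGKRankOneIntegral (one_lt_residueFieldCard_real)

namespace Summit.HodgeConjecture.HodgeConjecture.Cruxes.HLiu418.K2LiuRankOneLevelShells

variable {F : Type*} [Field F] [ValuativeRel F] [TopologicalSpace F] [IsNonarchimedeanLocalField F]

/-! ## §1 The outward shells `{‖x‖ = q^{j+1−n}}`, `j ≥ 0`, covering `𝕜 ∖ 𝔭^n` -/

/-- `0 < q` as a real number. [folklore] -/
theorem residueFieldCard_real_pos : (0 : ℝ) < (residueFieldCard F : ℝ) :=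
  zero_lt_one.trans one_lt_residueFieldCard_real

/-- On the shell `𝔭^{n−1−j} ∖ 𝔭^{n−j}` the normalised absolute value is `q^{j+1−n}` (as a real number). [cite: Tate1950, §2.5] -/
theorem coe_normAbs_of_mem_outerShell {n : ℤ} {j : ℕ} {x : F}
    (hx : x ∈ primePowBall F (n - 1 - j) \ primePowBall F (n - 1 - j + 1)) :
    ((normAbs F x : ℝ≥0) : ℝ) = (residueFieldCard F : ℝ) ^ ((j : ℤ) + 1 - n) := by
  rw [mem_shell_iff] at hx
  rw [hx, NNReal.coe_zpow, NNReal.coe_inv, NNReal.coe_natCast, inv_zpow', neg_sub, sub_sub_eq_add_sub]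

/-- Points of the outer shells are NOT in the head ball `𝔭^n` (`q^{j+1−n} > q^{−n}`). [cite: Tate1950, §2.5] -/
theorem not_mem_primePowBall_of_mem_outerShell {n : ℤ} {j : ℕ} {x : F}
    (hx : x ∈ primePowBall F (n - 1 - j) \ primePowBall F (n - 1 - j + 1)) : x ∉ primePowBall F n := by
  intro h0
  have h1 := mem_shell_iff.1 hx
  rw [mem_primePowBall_iff, h1] at h0
  have := (zpow_le_zpow_iff_right_of_lt_one₀ inv_residueFieldCard_pos inv_residueFieldCard_lt_one).1 h0
  omega

/-- elements of a shell are non-zero. [cite: Tate1950, §2.5] -/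
theorem ne_zero_of_mem_outerShell {n : ℤ} {j : ℕ} {x : F}
    (hx : x ∈ primePowBall F (n - 1 - j) \ primePowBall F (n - 1 - j + 1)) : x ≠ 0 :=
  ne_zero_of_mem_shell hx

/-- **`𝕜 ∖ 𝔭^n = ⋃_{j ≥ 0} (𝔭^{n−1−j} ∖ 𝔭^{n−j})`**: the complement of the head ball is the union of the outer shells
`‖x‖ = q^{j+1−n}`. [cite: Tate1950, §2.5] -/
theorem compl_primePowBall_eq_iUnion (n : ℤ) :
    (primePowBall F n)ᶜ = ⋃ j : ℕ, primePowBall F (n - 1 - j) \ primePowBall F (n - 1 - j + 1) := by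
  ext x
  simp only [Set.mem_compl_iff, Set.mem_iUnion]
  constructor
  · intro hx
    have hx0 : x ≠ 0 := by
      rintro rfl
      exact hx (zero_mem_primePowBall n)
    obtain ⟨k, hk⟩ := exists_normAbs_eq_inv_zpow hx0
    have hkn : k < n := by
      by_contra hkn
      apply hx
      rw [mem_primePowBall_iff, hk]
      exact zpow_le_zpow_right_of_le_one₀ inv_residueFieldCard_pos inv_residueFieldCard_lt_one.le (not_lt.1 hkn)
    refine ⟨(n - 1 - k).toNat, ?_⟩
    rw [mem_shell_iff, hk]
    congr 1
    omega
  · rintro ⟨j, hj⟩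
    exact not_mem_primePowBall_of_mem_outerShell hj

/-- The outer shells are pairwise disjoint. [cite: Tate1950, §2.5] -/
theorem pairwise_disjoint_outerShell (n : ℤ) :
    Pairwise (Function.onFun Disjoint fun j : ℕ => primePowBall F (n - 1 - j) \ primePowBall F (n - 1 - j + 1)) :=
  fun j j' h => disjoint_shell (by omega)

section Measure

variable [MeasurableSpace F] [BorelSpace F] (μ : Measure F) [μ.IsAddHaarMeasure]

/-- **Measure of the outer shell** `μ(𝔭^{n−1−j} ∖ 𝔭^{n−j}) = q^{j+1−n} (1 − q⁻¹) μ(𝒪)`. [cite: Tate1950, §2.2 Lemma 2.2.5] -/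
theorem measureReal_outerShell (n : ℤ) (j : ℕ) :
    μ.real (primePowBall F (n - 1 - j) \ primePowBall F (n - 1 - j + 1)) =
      (residueFieldCard F : ℝ) ^ ((j : ℤ) + 1 - n) * (1 - (residueFieldCard F : ℝ)⁻¹) * μ.real (primePowBall F 0) := by
  rw [measureReal_shell μ, inv_zpow', neg_sub, sub_sub_eq_add_sub]

/-! ## §2 The HEAD: a ball is a finite disjoint union of translates of a smaller ball; integrating a locally constant function -/

/-- the translate `{x | x − y ∈ 𝔭^r} = (−y + ·)⁻¹' 𝔭^r` is measurable and has measure `μ(𝔭^r)`. [folklore] -/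
theorem measurableSet_translate_and_measure_eq (y : F) (r : ℤ) :
    MeasurableSet {x : F | x - y ∈ primePowBall F r} ∧ μ {x : F | x - y ∈ primePowBall F r} = μ (primePowBall F r) := by
  have hset : {x : F | x - y ∈ primePowBall F r} = (fun x => -y + x) ⁻¹' primePowBall F r := by
    ext x; simp [neg_add_eq_sub]
  rw [hset]
  exact ⟨(measurableSet_primePowBall r).preimage (measurable_const_add (-y)), measure_preimage_add μ (-y) _⟩

/-- **The head as a finite sum.**  If `𝔭^n = ⨆_{y∈R} (y + 𝔭^r)` (representatives `R` as in ★ `exists_finset_primePowBall_eq_biUnion`) and `g` is constant on each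
translate (`g x = g y` for `x − y ∈ 𝔭^r`), then `g` is integrable on `𝔭^n` and `∫_{𝔭^n} g dμ = Σ_{y ∈ R} μ(𝔭^r) · g(y)`.
[cite: BushnellHenniart2006, §1.1] [cite: Tate1950, §2.5] -/
theorem integrableOn_and_setIntegral_head_eq_sum {n r : ℤ} (R : Finset F)
    (hRinc : ∀ y ∈ R, ∀ y' ∈ R, y ≠ y' → y - y' ∉ primePowBall F r)
    (hRcov : primePowBall F n = ⋃ y ∈ R, {x : F | x - y ∈ primePowBall F r})
    (g : F → ℂ) (hg : ∀ y ∈ R, ∀ x : F, x - y ∈ primePowBall F r → g x = g y) :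
    IntegrableOn g (primePowBall F n) μ ∧
      ∫ x in primePowBall F n, g x ∂μ = ∑ y ∈ R, (μ.real (primePowBall F r) : ℂ) * g y := by
  set T : F → Set F := fun y => {x : F | x - y ∈ primePowBall F r} with hT
  have hTm : ∀ y, MeasurableSet (T y) := fun y => (measurableSet_translate_and_measure_eq μ y r).1
  have hTμ : ∀ y, μ (T y) = μ (primePowBall F r) := fun y => (measurableSet_translate_and_measure_eq μ y r).2
  have hTfin : ∀ y, μ (T y) ≠ ∞ := fun y => by rw [hTμ]; exact (measure_primePowBall_lt_top μ r).ne
  -- pairwise disjoint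
  have hdisj : Set.Pairwise (↑R : Set F) (Function.onFun Disjoint T) := by
    intro y hy y' hy' hne
    refine Set.disjoint_left.2 fun x hx hx' => hRinc y hy y' hy' hne ?_
    have : y - y' = (x - y') - (x - y) := by ring
    rw [this, sub_eq_add_neg]
    exact add_mem_primePowBall hx' (neg_mem_primePowBall hx)
  -- on each translate `g` is the constant `g y`
  have hint : ∀ y ∈ R, IntegrableOn g (T y) μ := fun y hy =>
    IntegrableOn.congr_fun (integrableOn_const (hTfin y)) (fun x hx => (hg y hy x hx).symm) (hTm y)
  have hval : ∀ y ∈ R, ∫ x in T y, g x ∂μ = (μ.real (primePowBall F r) : ℂ) * g y := by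
    intro y hy
    rw [setIntegral_congr_fun (hTm y) (fun x hx => hg y hy x hx), setIntegral_const, Complex.real_smul, measureReal_def, hTμ,
      ← measureReal_def]
  have hcov : primePowBall F n = ⋃ y ∈ R, T y := hRcov
  refine ⟨?_, ?_⟩
  · rw [hcov]
    exact integrableOn_finset_iUnion.2 hint
  · rw [hcov, integral_biUnion_finset R (fun y _ => hTm y) hdisj hint]
    exact Finset.sum_congr rfl hval

/-! ## §3 The TAIL `C · ν(x)⁻¹ · ‖x‖^{−e}` on `𝕜 ∖ 𝔭^n` -/

omit [MeasurableSpace F] [BorelSpace F] in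
/-- `(q^k : ℝ)` as a complex power: `((q^k : ℝ) : ℂ)^z = q^{k z}` (`q > 0`, `k ∈ ℤ`). [folklore] -/
theorem ofReal_natCast_zpow_cpow (k : ℤ) (z : ℂ) :
    (((residueFieldCard F : ℝ) ^ k : ℝ) : ℂ) ^ z = (residueFieldCard F : ℂ) ^ ((k : ℂ) * z) := by
  rw [Complex.ofReal_zpow, Complex.ofReal_natCast]
  refine (Complex.cpow_int_mul' ?_ ?_ z).symm
  · rw [Complex.natCast_arg, mul_zero]; exact neg_lt_zero.2 Real.pi_pos
  · rw [Complex.natCast_arg, mul_zero]; exact Real.pi_pos.le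

variable {μ}

/-- **The tail on one shell, unramified character.**  For `ν` trivial on the units of norm `1` and `ϖ` a uniformizer, on the shell
`‖x‖ = q^{j+1−n}` one has `x = ϖ^{n−1−j}·u` with `‖u‖ = 1`, so `ν(x)⁻¹ = ν(ϖ)^{j+1−n}` and the integrand is the CONSTANT
`C ν(ϖ)^{k} q^{−k e}`, `k = j + 1 − n`; integrating against `μ(shell) = q^k (1 − q⁻¹) μ(𝒪)` gives `C (1 − q⁻¹) μ(𝒪) (ν(ϖ) q^{1−e})^k`.
[cite: Tate1950, §2.5] [cite: Casselman1980, §3] -/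
theorem setIntegral_outerShell_of_unramified (n : ℤ) (j : ℕ) (g : F → ℂ) (ν : Fˣ →* ℂˣ)
    (hun : ∀ u : Fˣ, normAbs F (u : F) = 1 → ν u = 1) (ϖ : Fˣ) (hϖ : normAbs F (ϖ : F) = (residueFieldCard F : ℝ≥0)⁻¹) (C e : ℂ)
    (htail : ∀ u : Fˣ, (u : F) ∉ primePowBall F n → g u = C * (((ν u)⁻¹ : ℂˣ) : ℂ) * ((normAbs F (u : F) : ℝ) : ℂ) ^ (-e)) :
    ∫ x in primePowBall F (n - 1 - j) \ primePowBall F (n - 1 - j + 1), g x ∂μ =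
      C * (1 - (residueFieldCard F : ℂ)⁻¹) * μ.real (primePowBall F 0) *
        (((ν ϖ : ℂˣ) : ℂ) * (residueFieldCard F : ℂ) ^ (1 - e)) ^ ((j : ℤ) + 1 - n) := by
  set S : Set F := primePowBall F (n - 1 - j) \ primePowBall F (n - 1 - j + 1) with hS
  have hq0 : (residueFieldCard F : ℂ) ≠ 0 := by exact_mod_cast residueFieldCard_ne_zero F
  -- the integrand is constant on the shell
  have hconst : ∀ x ∈ S, g x = C * ((((ν ϖ : ℂˣ) : ℂ) ^ ((j : ℤ) + 1 - n)) *
      (residueFieldCard F : ℂ) ^ ((((j : ℤ) + 1 - n : ℤ) : ℂ) * -e)) := by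
    intro x hx
    have hx0 : x ≠ 0 := ne_zero_of_mem_outerShell hx
    have hxS := mem_shell_iff.1 hx
    -- `x = ϖ^{n-1-j} · u`, `‖u‖ = 1`
    have hu1 : normAbs F ((ϖ ^ (-(n - 1 - (j : ℤ))) * Units.mk0 x hx0 : Fˣ) : F) = 1 := by
      rw [Units.val_mul, Units.val_zpow_eq_zpow_val, map_mul, map_zpow₀, hϖ, Units.val_mk0, hxS,
        ← zpow_add₀ inv_residueFieldCard_pos.ne']
      simp
    have hνx : ν (Units.mk0 x hx0) = (ν ϖ) ^ (n - 1 - (j : ℤ)) := by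
      have h := hun _ hu1
      rw [map_mul, map_zpow, zpow_neg, inv_mul_eq_one] at h
      exact h.symm
    have hg := htail (Units.mk0 x hx0) (by rw [Units.val_mk0]; exact not_mem_primePowBall_of_mem_outerShell hx)
    rw [Units.val_mk0] at hg
    rw [hg, hνx, ← zpow_neg, Units.val_zpow_eq_zpow_val, coe_normAbs_of_mem_outerShell hx, ofReal_natCast_zpow_cpow,
      show -(n - 1 - (j : ℤ)) = (j : ℤ) + 1 - n by ring, mul_assoc]
  rw [setIntegral_congr_fun (measurableSet_shell _) hconst, setIntegral_const, Complex.real_smul, ← hS,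
    show μ.real S = (residueFieldCard F : ℝ) ^ ((j : ℤ) + 1 - n) * (1 - (residueFieldCard F : ℝ)⁻¹) * μ.real (primePowBall F 0) from
      measureReal_outerShell μ n j]
  push_cast
  rw [mul_zpow, ← Complex.cpow_int_mul _ ((j : ℤ) + 1 - n) (1 - e)]
  have h1 : (residueFieldCard F : ℂ) ^ ((((j : ℤ) + 1 - n : ℤ) : ℂ) * (1 - e)) =
      (residueFieldCard F : ℂ) ^ ((j : ℤ) + 1 - n) * (residueFieldCard F : ℂ) ^ ((((j : ℤ) + 1 - n : ℤ) : ℂ) * -e) := by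
    rw [mul_sub, mul_one, sub_eq_add_neg, Complex.cpow_add _ _ hq0, Complex.cpow_intCast, mul_neg]
  rw [h1]
  push_cast
  ring

/-- **The tail on one shell, ramified character: it VANISHES.**  If `ν(u₀) ≠ 1` for some unit `u₀` of norm `1`, translation by `u₀`
preserves the shell and the Haar measure and multiplies the integrand `C ν(x)⁻¹ ‖x‖^{−e}` by `ν(u₀)⁻¹ ≠ 1`. [cite: Tate1950, §2.5] -/
theorem setIntegral_outerShell_of_ramified (n : ℤ) (j : ℕ) (g : F → ℂ) (ν : Fˣ →* ℂˣ)
    (hram : ∃ u₀ : Fˣ, normAbs F (u₀ : F) = 1 ∧ ν u₀ ≠ 1) (C e : ℂ)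
    (htail : ∀ u : Fˣ, (u : F) ∉ primePowBall F n → g u = C * (((ν u)⁻¹ : ℂˣ) : ℂ) * ((normAbs F (u : F) : ℝ) : ℂ) ^ (-e)) :
    ∫ x in primePowBall F (n - 1 - j) \ primePowBall F (n - 1 - j + 1), g x ∂μ = 0 := by
  obtain ⟨u₀, hu₀, hν₀⟩ := hram
  set S : Set F := primePowBall F (n - 1 - j) \ primePowBall F (n - 1 - j + 1) with hS
  -- the shell is stable under `x ↦ u₀ x`
  have hSmem : ∀ x : F, (u₀ : F) * x ∈ S ↔ x ∈ S := fun x => by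
    rw [hS, mem_shell_iff, mem_shell_iff, map_mul, hu₀, one_mul]
  -- the integrand transforms by `ν(u₀)⁻¹`
  have hmul : ∀ x ∈ S, g ((u₀ : F) * x) = (((ν u₀)⁻¹ : ℂˣ) : ℂ) * g x := by
    intro x hx
    have hx0 : x ≠ 0 := ne_zero_of_mem_outerShell hx
    have hx' : (u₀ : F) * x ∈ S := (hSmem x).2 hx
    have h1 := htail (u₀ * Units.mk0 x hx0)
      (by rw [Units.val_mul, Units.val_mk0]; exact not_mem_primePowBall_of_mem_outerShell hx')
    have h2 := htail (Units.mk0 x hx0) (by rw [Units.val_mk0]; exact not_mem_primePowBall_of_mem_outerShell hx)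
    rw [Units.val_mul, Units.val_mk0] at h1
    rw [Units.val_mk0] at h2
    rw [h1, h2, map_mul, mul_inv, Units.val_mul, map_mul, hu₀, one_mul]
    ring
  have hI : ∫ x, S.indicator g ((u₀ : F) * x) ∂μ = ∫ x, S.indicator g x ∂μ := integral_comp_mul_left_of_normAbs_eq_one μ _ hu₀
  have hI' : ∫ x, S.indicator g ((u₀ : F) * x) ∂μ = (((ν u₀)⁻¹ : ℂˣ) : ℂ) * ∫ x, S.indicator g x ∂μ := by
    rw [← integral_const_mul]
    refine integral_congr_ae (Filter.Eventually.of_forall fun x => ?_)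
    show S.indicator g ((u₀ : F) * x) = (((ν u₀)⁻¹ : ℂˣ) : ℂ) * S.indicator g x
    by_cases hx : x ∈ S
    · rw [Set.indicator_of_mem ((hSmem x).2 hx), Set.indicator_of_mem hx, hmul x hx]
    · rw [Set.indicator_of_notMem (fun h => hx ((hSmem x).1 h)), Set.indicator_of_notMem hx, mul_zero]
  have hne : (((ν u₀)⁻¹ : ℂˣ) : ℂ) ≠ 1 := by
    intro h
    apply hν₀
    have : (ν u₀)⁻¹ = 1 := Units.ext h
    exact inv_eq_one.1 this
  have hzero : ∫ x, S.indicator g x ∂μ = 0 := by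
    have h := hI.symm.trans hI'
    have h' : (1 - (((ν u₀)⁻¹ : ℂˣ) : ℂ)) * ∫ x, S.indicator g x ∂μ = 0 := by rw [sub_mul, one_mul, sub_eq_zero]; exact h
    exact (mul_eq_zero.1 h').resolve_left (sub_ne_zero.2 hne.symm)
  rw [← integral_indicator (measurableSet_shell _)]
  exact hzero

/-- **Integrability of the tail and its shell-by-shell sum.**  With `‖ν‖ = 1` and `re e > 1`, `‖g‖ = ‖C‖ q^{−k re e}` on the shell `‖x‖ = q^k`
(`k = j+1−n`), whose measure is `∝ q^k`: the shell norms form a geometric series of ratio `q^{1 − re e} < 1`.  Hence `g` is integrable on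
`𝕜 ∖ 𝔭^n` and `∫_{𝕜∖𝔭^n} g` is the sum of the shell integrals. [cite: Tate1950, §2.4] -/
theorem integrableOn_and_hasSum_tail (n : ℤ) (g : F → ℂ) (hgm : AEStronglyMeasurable g μ) (ν : Fˣ →* ℂˣ)
    (hν : ∀ u : Fˣ, ‖((ν u : ℂˣ) : ℂ)‖ = 1) (C e : ℂ) (he : 1 < e.re)
    (htail : ∀ u : Fˣ, (u : F) ∉ primePowBall F n → g u = C * (((ν u)⁻¹ : ℂˣ) : ℂ) * ((normAbs F (u : F) : ℝ) : ℂ) ^ (-e)) :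
    IntegrableOn g (primePowBall F n)ᶜ μ ∧
      HasSum (fun j : ℕ => ∫ x in primePowBall F (n - 1 - j) \ primePowBall F (n - 1 - j + 1), g x ∂μ)
        (∫ x in (primePowBall F n)ᶜ, g x ∂μ) := by
  set S : ℕ → Set F := fun j => primePowBall F (n - 1 - j) \ primePowBall F (n - 1 - j + 1) with hS
  set q : ℝ := (residueFieldCard F : ℝ) with hq
  have hq1 : 1 < q := one_lt_residueFieldCard_real
  have hq0 : 0 < q := residueFieldCard_real_pos
  have hSm : ∀ j, MeasurableSet (S j) := fun j => measurableSet_shell _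
  have hSfin : ∀ j, μ (S j) ≠ ∞ := fun j => ((measure_mono fun x hx => hx.1).trans_lt (measure_primePowBall_lt_top μ _)).ne
  -- the norm of `g` on the `j`-th shell
  have hnorm : ∀ (j : ℕ), ∀ x ∈ S j, ‖g x‖ = ‖C‖ * q ^ (-((((j : ℤ) + 1 - n : ℤ) : ℝ) * e.re)) := by
    intro j x hx
    have hx0 : x ≠ 0 := ne_zero_of_mem_outerShell hx
    have h := htail (Units.mk0 x hx0) (by rw [Units.val_mk0]; exact not_mem_primePowBall_of_mem_outerShell hx)
    rw [Units.val_mk0] at h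
    rw [h, norm_mul, norm_mul, Units.val_inv_eq_inv_val, norm_inv, hν, inv_one, mul_one, coe_normAbs_of_mem_outerShell hx,
      Complex.norm_cpow_eq_rpow_re_of_pos (zpow_pos hq0 _), Complex.neg_re, ← Real.rpow_intCast_mul hq0.le]
    congr 1
    push_cast
    ring
  -- integrable on each shell (bounded, measurable, finite measure)
  have hint : ∀ j, IntegrableOn g (S j) μ := fun j =>
    Measure.integrableOn_of_bounded (hSfin j) hgm
      ((ae_restrict_iff' (hSm j)).2 (Filter.Eventually.of_forall fun x hx => (hnorm j x hx).le))
  -- the shell norms are a geometric series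
  have hSnorm : ∀ j : ℕ, ∫ x in S j, ‖g x‖ ∂μ =
      ‖C‖ * (1 - q⁻¹) * μ.real (primePowBall F 0) * q ^ ((1 - e.re) * (1 - (n : ℝ))) * (q ^ (1 - e.re)) ^ j := by
    intro j
    rw [setIntegral_congr_fun (hSm j) (fun x hx => hnorm j x hx), setIntegral_const, smul_eq_mul]
    rw [show μ.real (S j) = q ^ (((j : ℤ) + 1 - n : ℤ) : ℝ) * (1 - q⁻¹) * μ.real (primePowBall F 0) by
          rw [hS]; simp only; rw [measureReal_outerShell μ n j, ← hq, ← Real.rpow_intCast]]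
    rw [show (q ^ (1 - e.re)) ^ j = q ^ ((1 - e.re) * (j : ℝ)) by rw [Real.rpow_mul hq0.le, Real.rpow_natCast]]
    have hsplit : q ^ (((j : ℤ) + 1 - n : ℤ) : ℝ) * q ^ (-((((j : ℤ) + 1 - n : ℤ) : ℝ) * e.re)) =
        q ^ ((1 - e.re) * (1 - (n : ℝ))) * q ^ ((1 - e.re) * (j : ℝ)) := by
      rw [← Real.rpow_add hq0, ← Real.rpow_add hq0]
      congr 1
      push_cast
      ring
    calc q ^ (((j : ℤ) + 1 - n : ℤ) : ℝ) * (1 - q⁻¹) * μ.real (primePowBall F 0) * (‖C‖ * q ^ (-((((j : ℤ) + 1 - n : ℤ) : ℝ) * e.re)))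
        = ‖C‖ * (1 - q⁻¹) * μ.real (primePowBall F 0) *
            (q ^ (((j : ℤ) + 1 - n : ℤ) : ℝ) * q ^ (-((((j : ℤ) + 1 - n : ℤ) : ℝ) * e.re))) := by ring
      _ = _ := by rw [hsplit]; ring
  have hratio : q ^ (1 - e.re) < 1 := Real.rpow_lt_one_of_one_lt_of_neg hq1 (by linarith)
  have hratio0 : 0 ≤ q ^ (1 - e.re) := Real.rpow_nonneg hq0.le _
  have hsum : Summable fun j : ℕ => ∫ x in S j, ‖g x‖ ∂μ := by
    simp_rw [hSnorm]
    exact (summable_geometric_of_lt_one hratio0 hratio).mul_left _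
  have hIU : IntegrableOn g (⋃ j, S j) μ := integrableOn_iUnion_of_summable_integral_norm hint hsum
  have hU : (⋃ j, S j) = (primePowBall F n)ᶜ := (compl_primePowBall_eq_iUnion n).symm
  refine ⟨hU ▸ hIU, ?_⟩
  have h := hasSum_integral_iUnion (μ := μ) (f := g) hSm (pairwise_disjoint_outerShell n) hIU
  rwa [hU] at h

end Measure

end Summit.HodgeConjecture.HodgeConjecture.Cruxes.HLiu418.K2LiuRankOneLevelShells

end
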